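/-
# [B4] THEOREM (1.9), THE HÖLDER MEMBER, ON A BOX — HYPOTHESIS-FREE FOR A REGULAR FIELD CONSTANT NEAR `∂Ω`,
UNIFORMLY IN `η`

statement-level skeleton of published theorems with citation tags; proofs where landed; nothing here is a claim about
the Yang–Mills mass gap

[B4] = Balaban, *Regularity and decay of lattice Green's functions*, Commun. Math. Phys. 89 (1983) 571–597.

THEOREM p.573 (1.9): «for α < 1 … |x−x′|^{−α}|U(A(Γ_{x,x′}))(D^η_{A,μ}G_k(Ω,A)f)(x′) − (D^η_{A,μ}G_k(Ω,A)f)(x)|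
≤ c₀exp(−δ₀dist({x,x′}, supp f))‖f‖_∞ … the constants are independent of η».  (v1.1 READING NOTE, ref-1 g27: the
words «the constants are independent of η» inside the guillemets are the typist's READING, not print.  P.573 prints, in
the Theorem, «there exist positive constants δ₀, c₀, R₀ independent of A, k, Ω and depending on d, M only, c₀ on α
also, such that for e sufficiently small …» — independence of the scale `k`, i.e. of `η = L^{−k}`; the sentence «The
constant γ₀ is independent of the lattice spacing η, as well as of Ω and of A» on p.573 is printed for (1.8).  Nothing
else in this file changes.)  `B4Thm19BoxHolderWalk.thm19_holder_box_
cubeField` reduced it, on a box `Ω` and for the print's `Ã_j`, to four per-cube inputs; THIS FILE discharges them for a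
(1.7)-regular component field `A = compField Ac` constant on the collar of width `K` at `∂Ω`, exactly as the lineage did
for the value and derivative members (`B4Thm110BoxRegular`, `B4Thm110BoxDerivRegular`): INTERIOR cubes by p35's
`lemma22_sup_cubeField` (.1 value, .2 derivatives, all directions), `eq220_cubeField` ((2.20)) and
`lemma22_holder_cubeField` (the Hölder input); BOUNDARY/OUTER cubes, where `Ã_j` is the CONSTANT configuration
`A(0)` (`cubeField_eq_constBond_of_collar`), by Lemma 2.2 at a constant field — value/derivative/(2.20) from
`const_inputs`, `const_inputs_deriv`, and the Hölder input `const_inputs_holder` proved here from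
`B4Lemma22HolderBox.lemma22_16_holder_field_explicit` at the ZERO field and p.581's gauge transformation putting the
constant part back (`holder_gauge`, `transport_gauge`, `covDeriv_gauge`, `b4Green_bondGauge`).

MAIN THEOREM `thm19_holder_box_regular`: for `0 ≤ α < 1` there are `K` (`16 ≤ K`, `4 ∣ K`) and `c₁ > 0` such that for
all `c ≥ 0`, `β > 0`, `S` there is `e₁ > 0` with — for every `k ≥ 1`, `(a,m²)` in the windows, box `Ω` (`K ∣ Mb_μ`,
`1 ≤ Mb_μ ≤ S`), (1.7)-regular `A` constant on the `K`-collar, `0 < e ≤ e₁`, direction `μ`, sites `x ≠ x′` with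
`x+e_μ, x′+e_μ ∈ Ω`, `32|x′−x|_∞ ≤ nK`, nearest-neighbour chain `Γ` from `x` to `x′` (`|Γ| ≤ (d+1)|x′−x|_∞`, inside the
`|x′−x|_∞`-ball), source `f` supported at unit-lattice sup-distance `≥ D` from `x`, `|f| ≤ φ` —
`(n/|x′−x|_∞)^α·|U(A(Γ))(D^η_{A,μ}G_k(Ω,A)f)(x′) − (D^η_{A,μ}G_k(Ω,A)f)(x)|_i ≤ c₁e^{−D/K}φ`, `c₁` independent of `η`.

HONEST SCOPE.  Boxes (general `Ω` of (1.8) not treated); `A` regular AND constant on the collar (the lineage's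
realisation of [13]'s extension trick is not formalised); pairs with `32|x′−x|_∞ ≤ nK` (farther pairs: derivative member
+ triangle inequality, not spelled out); the (1.7) window `e ≤ e₁(c,β,S,K)` depends on the box-size bound `S` through
p35's thresholds.  No `def`, no `Prop` fact, no `sorry`; axioms standard.
-/
import Literature.MathematicalPhysics.QuantumFieldTheory.Balaban1983to89.B4Thm19BoxHolderWalk
import Literature.MathematicalPhysics.QuantumFieldTheory.Balaban1983to89.B4Thm110BoxDerivRegular
import Literature.MathematicalPhysics.QuantumFieldTheory.Balaban1983to89.B4Lemma22HolderCubeField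

namespace Literature.MathematicalPhysics.QuantumFieldTheory.Balaban1983to89.B4Thm19BoxHolderRegular

open Literature.MathematicalPhysics.QuantumFieldTheory.Balaban1983to89.B4Reflection242 (boxDom nbrs mem_nbrs)
open Literature.MathematicalPhysics.QuantumFieldTheory.Balaban1983to89.B4GaugeCovariance
open Literature.MathematicalPhysics.QuantumFieldTheory.Balaban1983to89.B4Commutators25to211 (mulH)
open Literature.MathematicalPhysics.QuantumFieldTheory.Balaban1983to89.B4Lower18Regular (e1 lsum baseEmb stairContour
  stairContour_end transport_fieldLink)
open Literature.MathematicalPhysics.QuantumFieldTheory.Balaban1983to89.B4Lower18RegularRegion (compField)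
open Literature.MathematicalPhysics.QuantumFieldTheory.Balaban1983to89.B4Lemma21Region (siteNorm covDeriv)
open Literature.MathematicalPhysics.QuantumFieldTheory.Balaban1983to89.B4Lemma22ReduceZero (Box opA greenA derivA
  covDeriv_gauge supN_gauge_transpose)
open Literature.MathematicalPhysics.QuantumFieldTheory.Balaban1983to89.B4Lemma22Reduce231 (supN supN_nonneg)
open Literature.MathematicalPhysics.QuantumFieldTheory.Balaban1983to89.B4Lemma22Invertible (opA_stair_isUnit_det)
open Literature.MathematicalPhysics.QuantumFieldTheory.Balaban1983to89.B4PartitionUnity22 (hprof D1 D2 D1_nonneg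
  D2_nonneg contDiff_hprof hasCompactSupport_hprof)
open Literature.MathematicalPhysics.QuantumFieldTheory.Balaban1983to89.B4ContourShift (supNorm)
open Literature.MathematicalPhysics.QuantumFieldTheory.Balaban1983to89.B4Eq220PartitionSizes (hBox)
open Literature.MathematicalPhysics.QuantumFieldTheory.Balaban1983to89.B4Eq220CommutatorField (kOp)
open Literature.MathematicalPhysics.QuantumFieldTheory.Balaban1983to89.B4Lemma22HolderBox (IsNNChain
  lemma22_16_holder_field_explicit)
open Literature.MathematicalPhysics.QuantumFieldTheory.Balaban1983to89.B4Lemma22HolderCubeField (lemma22_holder_cubeField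
  holder_gauge constBond_add_eq_bondGauge)
open Literature.MathematicalPhysics.QuantumFieldTheory.Balaban1983to89.B4CubeFields22 (cubeField)
open Literature.MathematicalPhysics.QuantumFieldTheory.Balaban1983to89.B4CubeFieldHyps22 (fieldLink_smul greenA_smul
  constBond_smul)
open Literature.MathematicalPhysics.QuantumFieldTheory.Balaban1983to89.B4Eq220CubeField (eq220_cubeField
  lemma22_sup_cubeField)
open Literature.MathematicalPhysics.QuantumFieldTheory.Balaban1983to89.B4BoxCubeGeometry (posR labels)
open Literature.MathematicalPhysics.QuantumFieldTheory.Balaban1983to89.B4Thm110BoxRegular (greenA_congr_bonds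
  kOp_congr_bonds cubeField_eq_constBond_of_collar const_inputs)
open Literature.MathematicalPhysics.QuantumFieldTheory.Balaban1983to89.B4Thm110BoxDerivRegular (derivA_congr_bonds
  const_inputs_deriv)
open Literature.MathematicalPhysics.QuantumFieldTheory.Balaban1983to89.B4Thm19BoxHolderWalk (thm19_holder_box_cubeField)
open scoped Matrix

noncomputable section

variable {d : ℕ}
variable {ι : Type} [Fintype ι] [DecidableEq ι]

/-! ## 1. Transports of configurations agreeing on nearest-neighbour bonds; the zero bond sum -/

/-- configurations agreeing on nearest-neighbour bonds have the same transports along nearest-neighbour chains.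
[cite: Balaban1983RegularityDecay, (1.4) p.572, dictionary] -/
theorem transport_congr_nbrs (F : OrthFlow ι) (κ : ℝ) {R : Finset (Fin (d + 1) → ℤ)} {B B' : ↥R → ↥R → ℝ}
    (h : ∀ u v : ↥R, v.1 ∈ nbrs u.1 → B u v = B' u v) :
    ∀ (x : ↥R) (l : List ↥R), IsNNChain x l → transport (fieldLink F κ B) x l = transport (fieldLink F κ B') x l
  | _, [], _ => rfl
  | x, y :: l, hl => by
      have hl' : y.1 ∈ nbrs x.1 ∧ IsNNChain y l := hl
      show fieldLink F κ B x y * transport (fieldLink F κ B) y l = fieldLink F κ B' x y * transport (fieldLink F κ B') y l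
      rw [transport_congr_nbrs F κ h y l hl'.2, show fieldLink F κ B x y = F.U (κ * B x y) from rfl, h x y hl'.1]
      rfl

omit [Fintype ι] [DecidableEq ι] in
/-- the bond sum of the zero configuration vanishes. [folklore] -/
private theorem lsum_zero {X : Type*} : ∀ (x : X) (l : List X), lsum (0 : X → X → ℝ) x l = 0
  | _, [] => rfl
  | _, y :: l => by rw [lsum, lsum_zero y l, Pi.zero_apply, Pi.zero_apply, zero_add]

omit [Fintype ι] [DecidableEq ι] in
/-- the zero constant configuration is the zero bond function. [folklore] -/
private theorem constBond_zero' {X : Type*} (pos : X → Fin (d + 1) → ℤ) :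
    constBond (0 : Fin (d + 1) → ℝ) pos = 0 := by
  funext u v
  simp [constBond]

/-! ## 2. The Hölder input at a constant configuration (Lemma 2.2 at `A′ = 0`, gauge transformation of p.581) -/

/-- **THE HÖLDER INPUT AT A CONSTANT CONFIGURATION, UNIFORMLY**: there is `c_H⁰ > 0` such that for every `k ≥ 1`,
`(a,m²)` in the windows, box with `1 ≤ M_i`, coupling `κ`, constant part `A₀`, direction `μ`, sites `x ≠ x′` with forward
`μ`-bonds in the box, nearest-neighbour chain `Γ` from `x` to `x′` with `|Γ| ≤ (d+1)|x′−x|_∞` and every `Φ`: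
`(n/|x′−x|_∞)^α|U(A₀(Γ))(D^η_{A₀,μ}G_k(□,A₀)Φ)(x′) − (D^η_{A₀,μ}G_k(□,A₀)Φ)(x)| ≤ c_H⁰‖Φ‖_∞` — Lemma 2.2 (2.16) at the
zero field (`B4Lemma22HolderBox.lemma22_16_holder_field_explicit`, all smallness parameters `0`) transported to the
constant configuration by the gauge transformation `λ = −⟨κA₀,·⟩` («A₀ = 0 by the gauge transformation», p.581).
[cite: Balaban1983RegularityDecay, Lemma 2.2 (2.16) p.578, p.581] -/
theorem const_inputs_holder (F : OrthFlow ι) {ℓ₁ : ℝ} (hℓ₁ : 0 ≤ ℓ₁)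
    (hLip : ∀ t (v : ι → ℝ), ((F.U t - 1) *ᵥ v) ⬝ᵥ ((F.U t - 1) *ᵥ v) ≤ (ℓ₁ * t) ^ 2 * (v ⬝ᵥ v))
    (d ℓ : ℕ) (hℓ : 1 ≤ ℓ) (amin aplus m2plus : ℝ) (ha : 0 < amin) (α : ℝ) (hα0 : 0 ≤ α) (hα1 : α < 1) :
    ∃ cH₀ : ℝ, 0 < cH₀ ∧ ∀ (k : ℕ), 1 ≤ k → ∀ (hn : 1 ≤ (ℓ + 1) ^ k) (a m2 : ℝ),
      amin ≤ a → a ≤ aplus → 0 ≤ m2 → m2 ≤ m2plus → ∀ (M : Fin (d + 1) → ℕ), (∀ i, 1 ≤ M i) →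
      ∀ (κ : ℝ) (A₀ : Fin (d + 1) → ℝ) (μ : Fin (d + 1)) (x x' : ↥(Box d ℓ k M)),
        x.1 + e1 μ ∈ Box d ℓ k M → x'.1 + e1 μ ∈ Box d ℓ k M → x'.1 ≠ x.1 →
      ∀ (l : List ↥(Box d ℓ k M)), IsNNChain x l → pathEnd x l = x' →
        (l.length : ℝ) ≤ ((d : ℝ) + 1) * supNorm (x'.1 - x.1) →
      ∀ Φ : ↥(Box d ℓ k M) × ι → ℝ,
        ((((ℓ + 1) ^ k : ℕ) : ℝ) / supNorm (x'.1 - x.1)) ^ α *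
          siteNorm (transport (fieldLink F κ (constBond A₀ Subtype.val)) x l
              *ᵥ fld (derivA d F κ ℓ k M (constBond A₀ Subtype.val) μ
                    *ᵥ (greenA d F κ ℓ k a m2 M (baseEmb hn M) (stairContour hn M) (constBond A₀ Subtype.val)
                          *ᵥ Φ)) x'
            - fld (derivA d F κ ℓ k M (constBond A₀ Subtype.val) μ
                    *ᵥ (greenA d F κ ℓ k a m2 M (baseEmb hn M) (stairContour hn M) (constBond A₀ Subtype.val)
                          *ᵥ Φ)) x)
          ≤ cH₀ * supN Φ := by
  obtain ⟨c, c₁, hc, hc₁, hL⟩ := lemma22_16_holder_field_explicit F hℓ₁ hLip 1 d ℓ hℓ amin aplus m2plus ha α hα0 hα1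
  refine ⟨2 * c₁, by positivity, ?_⟩
  intro k hk hn a m2 e1' e2 e3 e4 M hM κ A₀ μ x x' hxμ hx'μ hne l hl hlend hlen Φ
  have ha' : 0 < a := lt_of_lt_of_le ha e1'
  -- Lemma 2.2 (2.16) at the zero field: every smallness parameter vanishes
  have hunit : IsUnit (opA d F 1 ℓ k a m2 M (baseEmb hn M) (stairContour hn M)
      (constBond (0 : Fin (d + 1) → ℝ) Subtype.val + 0)).det :=
    opA_stair_isUnit_det F 1 hℓ hk hn ha' e3 M _
  have hsm : ((d : ℝ) + 2) * c * (((d : ℝ) + 1) * ℓ₁ * (0 + 0) + ((d : ℝ) + 1) * ℓ₁ * 0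
      + ((d : ℝ) + 1) * ℓ₁ ^ 2 * 0 ^ 2 + B1.aSeq a ((ℓ : ℝ) + 1) k * (ℓ₁ * 0 * (2 + ℓ₁ * 0))) ≤ 1 / 2 := by
    norm_num
  -- the gauge putting the constant part back
  set σ : ↥(Box d ℓ k M) → ℝ := linGauge (fun ν => κ * A₀ ν) Subtype.val with hσ
  set g : ↥(Box d ℓ k M) → Matrix ι ι ℝ := fun u => F.U (1 * σ u) with hg_def
  have hg : IsGauge g := F.isGauge _
  have main := hL k hk a m2 e1' e2 e3 e4 M hM (baseEmb hn M) (stairContour hn M)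
    (fun y x hw => stairContour_end hn M y x hw) 0 0 0 0 0 0 hunit le_rfl zero_le_one
    (fun ν => by simp) (fun u v _ => by simp) le_rfl zero_le_one
    (fun ν u ue u' ue' _ _ => by simp) le_rfl (fun u z y ν _ _ => by simp) (fun u y ν _ _ => by simp) le_rfl
    (fun y x _ => by rw [lsum_zero]; simp) hsm μ x ⟨x.1 + e1 μ, hxμ⟩ x' ⟨x'.1 + e1 μ, hx'μ⟩ rfl rfl hne l hl
    hlend hlen ((blockDiag g)ᵀ *ᵥ Φ)
  rw [constBond_zero', add_zero, supN_gauge_transpose hg] at main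
  -- `κ·A₀ = (0)^σ`
  have hfield : (fun u v : ↥(Box d ℓ k M) => κ * constBond A₀ Subtype.val u v) = bondGauge σ 0 := by
    have h0 := constBond_add_eq_bondGauge (fun ν => κ * A₀ ν) (Subtype.val : ↥(Box d ℓ k M) → _)
      (0 : ↥(Box d ℓ k M) → ↥(Box d ℓ k M) → ℝ)
    rw [add_zero] at h0
    rw [← hσ] at h0
    rw [← h0]
    funext u v
    exact constBond_smul κ A₀ _ u v
  have hW : fieldLink F κ (constBond A₀ (Subtype.val : ↥(Box d ℓ k M) → _)) = gaugeKer g g (fieldLink F 1 0) := by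
    rw [fieldLink_smul, hfield, fieldLink_bondGauge]
  have hTr : transport (fieldLink F κ (constBond A₀ (Subtype.val : ↥(Box d ℓ k M) → _))) x l
      = g x * transport (fieldLink F 1 (0 : ↥(Box d ℓ k M) → ↥(Box d ℓ k M) → ℝ)) x l * (g x')ᵀ := by
    rw [hW, transport_gauge hg, hlend]
  have hDer : derivA d F κ ℓ k M (constBond A₀ Subtype.val) μ
      = blockDiag g * derivA d F 1 ℓ k M 0 μ * (blockDiag g)ᵀ := by
    unfold derivA
    rw [hW, covDeriv_gauge hg]
  have hGr : greenA d F κ ℓ k a m2 M (baseEmb hn M) (stairContour hn M) (constBond A₀ Subtype.val)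
      = blockDiag g * greenA d F 1 ℓ k a m2 M (baseEmb hn M) (stairContour hn M) 0 * (blockDiag g)ᵀ := by
    rw [greenA_smul, hfield]
    unfold greenA
    rw [b4Green_bondGauge F 1 _ m2 _ (fun y x hw => stairContour_end hn M y x hw) σ 0]
  rw [hTr, hDer, hGr, holder_gauge hg]
  exact main

/-! ## 3. THEOREM (1.9), Hölder member, on a box — hypothesis-free for a regular field constant near `∂Ω` -/

omit [Fintype ι] [DecidableEq ι] in
/-- a label that is not interior is a boundary/outer label (box sides multiples of `K`).
[cite: Balaban1983RegularityDecay, §2 p.575, dictionary] -/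
private theorem nonint {K : ℕ} {Mb : Fin (d + 1) → ℕ} {j : Fin (d + 1) → ℤ} (hKM : ∀ μ, K ∣ Mb μ)
    (h : ¬ ∀ μ, 1 ≤ j μ ∧ (K : ℤ) * (j μ + 1) ≤ (Mb μ : ℤ)) : ∃ μ, j μ ≤ 0 ∨ (Mb μ : ℤ) ≤ (K : ℤ) * j μ := by
  obtain ⟨μ, hμ⟩ := not_forall.mp h
  refine ⟨μ, ?_⟩
  by_cases h1 : 1 ≤ j μ
  · right
    have h2 : ¬ (K : ℤ) * (j μ + 1) ≤ (Mb μ : ℤ) := fun h2 => hμ ⟨h1, h2⟩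
    obtain ⟨t, ht⟩ := hKM μ
    have h3 : (Mb μ : ℤ) = (K : ℤ) * t := by rw [ht]; push_cast; ring
    rw [h3] at h2 ⊢
    have hK0 : (0 : ℤ) ≤ K := Int.natCast_nonneg K
    by_contra h4
    push Not at h4
    rcases eq_or_lt_of_le hK0 with h5 | h5
    · rw [← h5] at h4; simp at h4
    · have : t < j μ + 1 := by
        by_contra h6
        push Not at h6
        exact h2 (mul_le_mul_of_nonneg_left h6 hK0)
      have : j μ < t := lt_of_mul_lt_mul_left h4 hK0
      omega
  · left
    omega

/-- **THEOREM (1.9) OF [B4] ON A BOX, HÖLDER MEMBER — FOR A (1.7)-REGULAR FIELD CONSTANT NEAR `∂Ω`, WITH «e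
SUFFICIENTLY SMALL» AND THE LARGE-CUBE SIZE CHOSEN, THE CONSTANT UNIFORM IN THE LATTICE SPACING `η = L^{-k}`**: for
`0 ≤ α < 1` there are `K` (`16 ≤ K`, `4 ∣ K`) and `c₁ > 0` such that for all `c ≥ 0`, `β > 0`, `S` there is `e₁ > 0`
with — for every `k ≥ 1`, `(a,m²) ∈ [a₋,a₊]×[0,m²₊]`, box `Ω = Π[0, nMb_μ)` with `K ∣ Mb_μ`, `1 ≤ Mb_μ ≤ S`, component
field `A` with `|A_ν(x+e_μ) − A_ν(x)| ≤ c·e^{β−1}η` on `Ω`, `0 < e ≤ e₁`, `A = A(0)` on the collar of width `K` at `∂Ω`,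
direction `μ`, fine sites `x ≠ x′` with `x + e_μ, x′ + e_μ ∈ Ω` and `32|x′ − x|_∞ ≤ nK`, a nearest-neighbour chain `Γ`
from `x` to `x′` with `|Γ| ≤ (d+1)|x′−x|_∞` inside the `|x′−x|_∞`-ball about `x`, set `P` with `|x/n − x″/n|_∞ ≥ D` on
`P`, source `f` supported in `P` with `|f| ≤ φ` —
`(n/|x′−x|_∞)^α·|U(A(Γ))(D^η_{A,μ}G_k(Ω,A)f)(x′) − (D^η_{A,μ}G_k(Ω,A)f)(x)|_i ≤ c₁·e^{−D/K}·φ`.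
[cite: Balaban1983RegularityDecay, Theorem (1.9) p.573; pp.575–579, p.581] -/
theorem thm19_holder_box_regular (F : OrthFlow ι) {ℓ₁ : ℝ} (hℓ₁ : 0 ≤ ℓ₁)
    (hLip : ∀ t (v : ι → ℝ), ((F.U t - 1) *ᵥ v) ⬝ᵥ ((F.U t - 1) *ᵥ v) ≤ (ℓ₁ * t) ^ 2 * (v ⬝ᵥ v))
    (d ℓ : ℕ) (hℓ : 1 ≤ ℓ) (amin aplus m2plus : ℝ) (ha : 0 < amin) (α : ℝ) (hα0 : 0 ≤ α) (hα1 : α < 1) :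
    ∃ K : ℕ, 16 ≤ K ∧ 4 ∣ K ∧ ∃ c₁ : ℝ, 0 < c₁ ∧ ∀ (creg β : ℝ), 0 ≤ creg → 0 < β → ∀ (S : ℕ),
      ∃ e₁ : ℝ, 0 < e₁ ∧ ∀ (k : ℕ), 1 ≤ k → ∀ (hn : 1 ≤ (ℓ + 1) ^ k) (a m2 : ℝ),
      amin ≤ a → a ≤ aplus → 0 ≤ m2 → m2 ≤ m2plus →
      ∀ (Mb : Fin (d + 1) → ℕ), (∀ i, 1 ≤ Mb i) → (∀ i, Mb i ≤ S) → (∀ μ, K ∣ Mb μ) →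
      ∀ (Ac : (Fin (d + 1) → ℤ) → Fin (d + 1) → ℝ) (e : ℝ), 0 < e → e ≤ e₁ →
        (∀ x ∈ Box d ℓ k Mb, ∀ μ ν : Fin (d + 1),
          |Ac (x + e1 μ) ν - Ac x ν| ≤ creg * e ^ (β - 1) / ((ℓ + 1) ^ k : ℕ)) →
        (∀ w ∈ Box d ℓ k Mb, (∃ μ, w μ < (((ℓ + 1) ^ k : ℕ) : ℤ) * K ∨
            (((ℓ + 1) ^ k : ℕ) : ℤ) * Mb μ < w μ + (((ℓ + 1) ^ k : ℕ) : ℤ) * K) → ∀ ν, Ac w ν = Ac 0 ν) →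
      ∀ (μ : Fin (d + 1)) (x x' : ↥(Box d ℓ k Mb)), x.1 + e1 μ ∈ Box d ℓ k Mb → x'.1 + e1 μ ∈ Box d ℓ k Mb →
        x'.1 ≠ x.1 → 32 * supNorm (x'.1 - x.1) ≤ (((ℓ + 1) ^ k : ℕ) : ℝ) * K →
      ∀ (l : List ↥(Box d ℓ k Mb)), IsNNChain x l → pathEnd x l = x' →
        (l.length : ℝ) ≤ ((d : ℝ) + 1) * supNorm (x'.1 - x.1) →
        (∀ z ∈ l, supNorm (z.1 - x.1) ≤ supNorm (x'.1 - x.1)) →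
      ∀ (P : ↥(Box d ℓ k Mb) → Prop) [DecidablePred P] (D : ℝ),
        (∀ x'', P x'' → ∃ ν, D ≤ |posR ℓ k Mb x ν - posR ℓ k Mb x'' ν|) →
      ∀ (f : ↥(Box d ℓ k Mb) × ι → ℝ), (∀ p, ¬ P p.1 → f p = 0) → ∀ (φ : ℝ), 0 ≤ φ → (∀ p, |f p| ≤ φ) →
      ∀ i : ι,
        ((((ℓ + 1) ^ k : ℕ) : ℝ) / supNorm (x'.1 - x.1)) ^ α *
          |(transport (fieldLink F (e / ((ℓ + 1) ^ k : ℕ)) (fun u v : ↥(Box d ℓ k Mb) => compField Ac u.1 v.1)) x l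
              *ᵥ fld (derivA d F (e / ((ℓ + 1) ^ k : ℕ)) ℓ k Mb (fun u v : ↥(Box d ℓ k Mb) => compField Ac u.1 v.1) μ
                    *ᵥ (greenA d F (e / ((ℓ + 1) ^ k : ℕ)) ℓ k a m2 Mb (baseEmb hn Mb) (stairContour hn Mb)
                        (fun u v : ↥(Box d ℓ k Mb) => compField Ac u.1 v.1) *ᵥ f)) x'
            - fld (derivA d F (e / ((ℓ + 1) ^ k : ℕ)) ℓ k Mb (fun u v : ↥(Box d ℓ k Mb) => compField Ac u.1 v.1) μ
                    *ᵥ (greenA d F (e / ((ℓ + 1) ^ k : ℕ)) ℓ k a m2 Mb (baseEmb hn Mb) (stairContour hn Mb)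
                        (fun u v : ↥(Box d ℓ k Mb) => compField Ac u.1 v.1) *ᵥ f)) x) i|
          ≤ c₁ * Real.exp (-(D / K)) * φ := by
  obtain ⟨C₁, hC₁, h₁⟩ := lemma22_sup_cubeField F hℓ₁ hLip d ℓ hℓ amin aplus m2plus ha
  obtain ⟨C₂, hC₂, h₂⟩ := eq220_cubeField F hℓ₁ hLip d ℓ hℓ amin aplus m2plus ha
  obtain ⟨C₃, hC₃, h₃⟩ := lemma22_holder_cubeField F hℓ₁ hLip d ℓ hℓ amin aplus m2plus ha α hα0 hα1
  obtain ⟨cG₀, cK₀, hcG₀, hcK₀, h₀⟩ := const_inputs F hℓ₁ hLip d ℓ hℓ amin aplus m2plus ha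
  obtain ⟨cD₀, hcD₀, h₀'⟩ := const_inputs_deriv F d ℓ hℓ amin aplus m2plus ha
  obtain ⟨cH₀, hcH₀, h₀''⟩ := const_inputs_holder F hℓ₁ hLip d ℓ hℓ amin aplus m2plus ha α hα0 hα1
  set X : ℝ := (3 : ℝ) ^ (d + 1) * Real.sqrt (Fintype.card ι) * (C₂ + cK₀) * Real.exp 1 with hX
  have hX0 : 0 ≤ X := by positivity
  set K : ℕ := 16 * (⌈X⌉₊ + 1) with hK
  have hK16 : 16 ≤ K := by omega
  have h4 : 4 ∣ K := ⟨4 * (⌈X⌉₊ + 1), by omega⟩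
  have hK2 : 2 ≤ K := by omega
  have hK1 : 1 ≤ K := by omega
  have hKr : (0 : ℝ) < K := by exact_mod_cast hK1
  have hKX : X ≤ K := by
    refine (Nat.le_ceil X).trans ?_
    rw [hK]
    push_cast
    linarith [(Nat.cast_nonneg ⌈X⌉₊ : (0 : ℝ) ≤ ⌈X⌉₊)]
  set cG : ℝ := max C₁ cG₀ with hcG_def
  set cD : ℝ := max C₁ cD₀ with hcD_def
  set cH : ℝ := max C₃ cH₀ with hcH_def
  set cK : ℝ := (C₂ + cK₀) / K with hcK_def
  have hcG : 0 ≤ cG := hC₁.le.trans (le_max_left _ _)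
  have hcD : 0 ≤ cD := hC₁.le.trans (le_max_left _ _)
  have hcH : 0 ≤ cH := hC₃.le.trans (le_max_left _ _)
  have hcK : 0 ≤ cK := div_nonneg (by positivity) hKr.le
  have h3 : (3 : ℝ) ^ (d + 1) * (Real.sqrt (Fintype.card ι) * cK) ≤ Real.exp (-1) := by
    have hexp : Real.exp 1 * Real.exp (-1) = 1 := by rw [← Real.exp_add]; norm_num
    have e : (3 : ℝ) ^ (d + 1) * (Real.sqrt (Fintype.card ι) * cK) = X / K * Real.exp (-1) := by
      rw [hcK_def, hX]
      calc (3 : ℝ) ^ (d + 1) * (Real.sqrt (Fintype.card ι) * ((C₂ + cK₀) / K))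
          = (3 : ℝ) ^ (d + 1) * Real.sqrt (Fintype.card ι) * (C₂ + cK₀) / K * (Real.exp 1 * Real.exp (-1)) := by
            rw [hexp]; ring
        _ = (3 : ℝ) ^ (d + 1) * Real.sqrt (Fintype.card ι) * (C₂ + cK₀) * Real.exp 1 / K * Real.exp (-1) := by
            ring
    rw [e]
    have : X / K ≤ 1 := div_le_one_of_le₀ hKX (Nat.cast_nonneg K)
    calc X / K * Real.exp (-1) ≤ 1 * Real.exp (-1) := mul_le_mul_of_nonneg_right this (Real.exp_pos _).le
      _ = Real.exp (-1) := one_mul _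
  have hD1 := D1_nonneg contDiff_hprof hasCompactSupport_hprof
  have hD2 := D2_nonneg contDiff_hprof hasCompactSupport_hprof
  set c₁ : ℝ := 2 ^ (d + 4) * Real.exp (5 / 2)
    * (Real.sqrt (Fintype.card ι) * (cH + ((d : ℝ) + 1) * D1 hprof * cD
        + ((d : ℝ) + 3) * (((d : ℝ) + 1) * (D1 hprof + D2 hprof)) * cD
        + ((d : ℝ) + 1) * (D1 hprof ^ 2 + D2 hprof) * cG)) + 1 with hc₁
  refine ⟨K, hK16, h4, c₁, by positivity, fun creg β hcreg hβ S => ?_⟩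
  obtain ⟨e₁, he₁, h₁'⟩ := h₁ creg β hcreg hβ S K hK1
  obtain ⟨e₂, he₂, h₂'⟩ := h₂ creg β hcreg hβ S K hK2
  obtain ⟨e₃, he₃, h₃'⟩ := h₃ creg β hcreg hβ S K hK1
  refine ⟨min (min e₁ e₂) e₃, lt_min (lt_min he₁ he₂) he₃, ?_⟩
  intro k hk hn a m2 ea1 ea2 em1 em2 Mb hM hS hKM Ac e he hle h17 hcol μ x x' hxμ hx'μ hne hclose l hl hlend hlen
    hlnear P _ D hD f hfP φ hφ hf i
  have hle1 : e ≤ e₁ := hle.trans ((min_le_left _ _).trans (min_le_left _ _))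
  have hle2 : e ≤ e₂ := hle.trans ((min_le_left _ _).trans (min_le_right _ _))
  have hle3 : e ≤ e₃ := hle.trans (min_le_right _ _)
  have hn2 : 2 ≤ (ℓ + 1) ^ k := by
    calc 2 ≤ ℓ + 1 := by omega
      _ = (ℓ + 1) ^ 1 := (pow_one _).symm
      _ ≤ (ℓ + 1) ^ k := Nat.pow_le_pow_right (Nat.succ_pos ℓ) hk
  have hnK : 16 ≤ (ℓ + 1) ^ k * K := by nlinarith
  have ha' : 0 < a := lt_of_lt_of_le ha ea1
  have hcol' : ∀ w : ↥(Box d ℓ k Mb), (∃ μ, w.1 μ < (((ℓ + 1) ^ k : ℕ) : ℤ) * K ∨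
      (((ℓ + 1) ^ k : ℕ) : ℤ) * Mb μ < w.1 μ + (((ℓ + 1) ^ k : ℕ) : ℤ) * K) → ∀ ν, Ac w.1 ν = Ac 0 ν :=
    fun w hw => hcol w.1 w.2 hw
  have hG : ∀ j ∈ labels Mb, ∀ Φ : ↥(Box d ℓ k Mb) × ι → ℝ,
      supN (greenA d F (e / ((ℓ + 1) ^ k : ℕ)) ℓ k a m2 Mb (baseEmb hn Mb) (stairContour hn Mb)
          (cubeField (Box d ℓ k Mb) ((ℓ + 1) ^ k) K j (Ac 0) Ac) *ᵥ Φ) ≤ cG * supN Φ := by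
    intro j _ Φ
    by_cases hint : ∀ μ, 1 ≤ j μ ∧ (K : ℤ) * (j μ + 1) ≤ (Mb μ : ℤ)
    · have hb := (h₁' k hk hn hnK a m2 ea1 ea2 em1 em2 Mb hM hS j (fun μ => (hint μ).1) (fun μ => (hint μ).2)
        Ac e he hle1 h17 Φ).1
      exact hb.trans (mul_le_mul_of_nonneg_right (le_max_left _ _) (supN_nonneg Φ))
    · rw [greenA_congr_bonds F _ hn a m2 Mb (cubeField_eq_constBond_of_collar hn hK1 Ac (nonint hKM hint) hcol')]
      exact ((h₀ k hk hn a m2 ea1 ea2 em1 em2 Mb hM K j hK2 hKM _ (Ac 0)).1 Φ).trans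
        (mul_le_mul_of_nonneg_right (le_max_right _ _) (supN_nonneg Φ))
  have hDG : ∀ j ∈ labels Mb, ∀ (ν : Fin (d + 1)) (Φ : ↥(Box d ℓ k Mb) × ι → ℝ),
      supN (derivA d F (e / ((ℓ + 1) ^ k : ℕ)) ℓ k Mb (cubeField (Box d ℓ k Mb) ((ℓ + 1) ^ k) K j (Ac 0) Ac) ν
        *ᵥ (greenA d F (e / ((ℓ + 1) ^ k : ℕ)) ℓ k a m2 Mb (baseEmb hn Mb) (stairContour hn Mb)
            (cubeField (Box d ℓ k Mb) ((ℓ + 1) ^ k) K j (Ac 0) Ac) *ᵥ Φ)) ≤ cD * supN Φ := by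
    intro j _ ν Φ
    by_cases hint : ∀ μ, 1 ≤ j μ ∧ (K : ℤ) * (j μ + 1) ≤ (Mb μ : ℤ)
    · have hb := (h₁' k hk hn hnK a m2 ea1 ea2 em1 em2 Mb hM hS j (fun μ => (hint μ).1) (fun μ => (hint μ).2)
        Ac e he hle1 h17 Φ).2 ν
      exact hb.trans (mul_le_mul_of_nonneg_right (le_max_left _ _) (supN_nonneg Φ))
    · have hb := cubeField_eq_constBond_of_collar hn hK1 Ac (nonint hKM hint) hcol'
      rw [derivA_congr_bonds F _ Mb hb ν, greenA_congr_bonds F _ hn a m2 Mb hb]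
      exact (h₀' k hk hn a m2 ea1 ea2 em1 em2 Mb hM _ (Ac 0) ν Φ).trans
        (mul_le_mul_of_nonneg_right (le_max_right _ _) (supN_nonneg Φ))
  have hKG : ∀ j ∈ labels Mb, ∀ Φ : ↥(Box d ℓ k Mb) × ι → ℝ,
      supN (kOp F (e / ((ℓ + 1) ^ k : ℕ)) ((ℓ + 1) ^ k) (B1.aSeq a ((ℓ : ℝ) + 1) k) m2 Mb (baseEmb hn Mb)
            (stairContour hn Mb) (cubeField (Box d ℓ k Mb) ((ℓ + 1) ^ k) K j (Ac 0) Ac) (hBox ((ℓ + 1) ^ k) K Mb j)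
          *ᵥ (greenA d F (e / ((ℓ + 1) ^ k : ℕ)) ℓ k a m2 Mb (baseEmb hn Mb) (stairContour hn Mb)
              (cubeField (Box d ℓ k Mb) ((ℓ + 1) ^ k) K j (Ac 0) Ac)
            *ᵥ (mulH (ι := ι) (hBox ((ℓ + 1) ^ k) K Mb j) *ᵥ Φ))) ≤ cK * supN Φ := by
    intro j _ Φ
    have hsplit : ∀ t : ℝ, 0 ≤ t → t ≤ C₂ + cK₀ → t / K * supN Φ ≤ cK * supN Φ := fun t _ ht =>
      mul_le_mul_of_nonneg_right (div_le_div_of_nonneg_right ht hKr.le) (supN_nonneg Φ)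
    by_cases hint : ∀ μ, 1 ≤ j μ ∧ (K : ℤ) * (j μ + 1) ≤ (Mb μ : ℤ)
    · have hb := h₂' k hk hn hnK a m2 ea1 ea2 em1 em2 Mb hM hS hKM j (fun μ => (hint μ).1)
        (fun μ => (hint μ).2) Ac e he hle2 h17 Φ
      exact hb.trans (hsplit C₂ hC₂.le (by linarith))
    · have hb := cubeField_eq_constBond_of_collar hn hK1 Ac (nonint hKM hint) hcol'
      rw [kOp_congr_bonds F _ hn a m2 Mb hb, greenA_congr_bonds F _ hn a m2 Mb hb]
      exact ((h₀ k hk hn a m2 ea1 ea2 em1 em2 Mb hM K j hK2 hKM _ (Ac 0)).2 Φ).trans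
        (hsplit cK₀ hcK₀.le (by linarith))
  have hHG : ∀ j ∈ labels Mb, ∀ Φ : ↥(Box d ℓ k Mb) × ι → ℝ,
      ((((ℓ + 1) ^ k : ℕ) : ℝ) / supNorm (x'.1 - x.1)) ^ α *
        siteNorm (transport (fieldLink F (e / ((ℓ + 1) ^ k : ℕ))
              (cubeField (Box d ℓ k Mb) ((ℓ + 1) ^ k) K j (Ac 0) Ac)) x l
            *ᵥ fld (derivA d F (e / ((ℓ + 1) ^ k : ℕ)) ℓ k Mb (cubeField (Box d ℓ k Mb) ((ℓ + 1) ^ k) K j (Ac 0) Ac) μ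
                  *ᵥ (greenA d F (e / ((ℓ + 1) ^ k : ℕ)) ℓ k a m2 Mb (baseEmb hn Mb) (stairContour hn Mb)
                      (cubeField (Box d ℓ k Mb) ((ℓ + 1) ^ k) K j (Ac 0) Ac) *ᵥ Φ)) x'
          - fld (derivA d F (e / ((ℓ + 1) ^ k : ℕ)) ℓ k Mb (cubeField (Box d ℓ k Mb) ((ℓ + 1) ^ k) K j (Ac 0) Ac) μ
                  *ᵥ (greenA d F (e / ((ℓ + 1) ^ k : ℕ)) ℓ k a m2 Mb (baseEmb hn Mb) (stairContour hn Mb)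
                      (cubeField (Box d ℓ k Mb) ((ℓ + 1) ^ k) K j (Ac 0) Ac) *ᵥ Φ)) x)
        ≤ cH * supN Φ := by
    intro j _ Φ
    by_cases hint : ∀ μ, 1 ≤ j μ ∧ (K : ℤ) * (j μ + 1) ≤ (Mb μ : ℤ)
    · have hb := h₃' k hk hn hnK a m2 ea1 ea2 em1 em2 Mb hM hS j (fun μ => (hint μ).1) (fun μ => (hint μ).2)
        Ac e he hle3 h17 μ x ⟨x.1 + e1 μ, hxμ⟩ x' ⟨x'.1 + e1 μ, hx'μ⟩ rfl rfl hne l hl hlend hlen Φ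
      exact hb.trans (mul_le_mul_of_nonneg_right (le_max_left _ _) (supN_nonneg Φ))
    · have hb := cubeField_eq_constBond_of_collar hn hK1 Ac (nonint hKM hint) hcol'
      rw [transport_congr_nbrs F _ hb x l hl, derivA_congr_bonds F _ Mb hb μ, greenA_congr_bonds F _ hn a m2 Mb hb]
      exact (h₀'' k hk hn a m2 ea1 ea2 em1 em2 Mb hM _ (Ac 0) μ x x' hxμ hx'μ hne l hl hlend hlen Φ).trans
        (mul_le_mul_of_nonneg_right (le_max_right _ _) (supN_nonneg Φ))
  have main := thm19_holder_box_cubeField F hℓ hk hn Mb hK16 h4 hKM ha' em1 e Ac hcG hcD hcH hcK hG hDG hKG h3 μ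
    x x' hxμ hx'μ hne hclose l hl hlend hlen hlnear hα0 hα1.le hHG P hD f hfP hφ hf i
  refine main.trans (mul_le_mul_of_nonneg_right (mul_le_mul_of_nonneg_right ?_ (Real.exp_pos _).le) hφ)
  rw [hc₁]
  linarith

end

end Literature.MathematicalPhysics.QuantumFieldTheory.Balaban1983to89.B4Thm19BoxHolderRegular
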